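import Summits.ResolutionOfSingularities.ResolutionOfSingularities.Theorems.SplitTowerChartZU

/-!
# SplitTower (T7/·) — THE CHART LAWS II: the points of the blow-up OVER THE GENERIC POINT OF THE CURVE

Node «SplitTower» of `decomp-res-lens-2` (g34), see `Theorems/MaxContactCutSplitTower.lean`.

Setting: `A` local, `c = (c_l)_{l<m}` quasi-regular with `(c) = 𝔓` PRIME (the stalk of the curve's ideal at a CLOSED point);
`B_j = A[c/c_j]` a Rees chart.  The points of the blow-up lying over the generic point of the curve `V(𝔓)` and meeting
the chart are the primes `𝔴 ⊆ B_j` with `φ⁻¹ 𝔴 = 𝔓`.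

* §Q `quotMap` — `Φ_𝔓 : B_j ↠ (A/𝔓)[X_l : l ≠ j]` (`ShallowCut.chartQuot` read through `(c) = 𝔓`): `Φ e_l = X_l`,
  `Φ(φ a) = ā`, surjective, `ker Φ ⊆ 𝔴` whenever `φ c_j ∈ 𝔴`; for a prime `𝔴` over `𝔓` its image `Φ(𝔴)` is a prime
  DISJOINT FROM THE NON-ZERO CONSTANTS, so it survives in `K[X]`, `K = Frac(A/𝔓)` (`generic_fibre`).
* §O `originP` — THE ORIGIN OVER `𝔓`: `𝔴̃₀ = (e_l : l ≠ j) + (φ c_j) = ker(B_j ↠ (A/𝔓)[X] ↠ A/𝔓)`, a prime with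
  `φ⁻¹ 𝔴̃₀ = 𝔓`, THE UNIQUE prime over `𝔓` containing the `e_l`, and contained in every ideal over `𝔓 ⊆ ·` containing them
  (in particular in the closed origin `𝔴₀`).
* §G `SplitShape.generic_chart` — THE GENERIC LAW: for a split shape `D` (curve prime `𝔓 = (c)`), a prime `𝔴 ⊆ B_j`
  over `𝔓` and `S = (B_j)_𝔴`: if the controlled transform `J' = (J S : tⁿ)` lies in `𝔪_Sⁿ` then `j = 2` and `𝔴 = 𝔴̃₀`
  (the abstract `NotPow` chart law of T6 §N with `K = Frac(A/𝔓)` and `SplitShape.notPow_quot`).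

Sources: [StacksProject, Tag 052P, Tag 00UI]; [Hironaka1964] Ch. III §3; [CossartJannsenSaito2020] Ch. 2, Ch. 8.
-/

open IsLocalRing
open Literature.AlgebraicGeometry.Resolution
open Summit.ResolutionOfSingularities.ResolutionOfSingularities.Theorems.SplitCut (splitCone)
open Summit.ResolutionOfSingularities.ResolutionOfSingularities.Theorems.JetCut (WtIdeal)

namespace Summit.ResolutionOfSingularities.ResolutionOfSingularities.Theorems.SplitTower

variable {A : Type} [CommRing A]

/-! ## §Q  The quotient fibre map over the curve prime -/

section QuotMap

open MvPolynomial

variable {m : ℕ} (c : Fin m → A) (j : Fin m) (hq : IsQuasiRegular c) {P : Ideal A}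
  (hP : Ideal.span (Set.range c) = P)

/-- `Φ_𝔓 : B_j ↠ (A/𝔓)[X_l : l ≠ j]`, the quotient dictionary `ShallowCut.chartQuot` read through `(c) = 𝔓`.
[cite: StacksProject, Tag 052P] -/
noncomputable def quotMap : chartRing c j →+* MvPolynomial {i : Fin m // i ≠ j} (A ⧸ P) :=
  (MvPolynomial.map (Ideal.quotEquivOfEq hP).toRingHom).comp (ShallowCut.chartQuot c j hq)

/-- `Φ(e_l) = X_l`. [folklore] -/
theorem quotMap_gen {l : Fin m} (hl : l ≠ j) : quotMap c j hq hP (chartGen c j l) = X ⟨l, hl⟩ := by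
  simp [quotMap, ShallowCut.chartQuot_gen c j hq hl, map_X]

/-- `Φ(φ a) = C ā`. [folklore] -/
theorem quotMap_base (a : A) : quotMap c j hq hP (chartBase c j a) = C (Ideal.Quotient.mk P a) := by
  simp [quotMap, ShallowCut.chartQuot_base, map_C, Ideal.quotEquivOfEq_mk]

/-- `Φ` is surjective. [folklore] -/
theorem quotMap_surjective : Function.Surjective (quotMap c j hq hP) :=
  (MvPolynomial.map_surjective _ (Ideal.quotEquivOfEq hP).surjective).comp (ShallowCut.chartQuot_surjective c j hq)

/-- `ker Φ ⊆ 𝔴` for every ideal `𝔴 ∋ φ(c_j)`. [folklore] -/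
theorem ker_quotMap_le {𝔴 : Ideal (chartRing c j)} (h𝔴 : chartBase c j (c j) ∈ 𝔴) :
    RingHom.ker (quotMap c j hq hP) ≤ 𝔴 := by
  intro b hb
  refine ShallowCut.ker_chartQuot_le c j hq h𝔴 ?_
  rw [RingHom.mem_ker] at hb ⊢
  exact MvPolynomial.map_injective _ (Ideal.quotEquivOfEq hP).injective (by simpa [quotMap] using hb)

/-- For an ideal `𝔴 ∋ φ(c_j)`: `Φ(𝔴)` reflects membership, and is prime if `𝔴` is. [folklore] -/
theorem map_quotMap_reflects {𝔴 : Ideal (chartRing c j)} (h𝔴 : chartBase c j (c j) ∈ 𝔴) :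
    (𝔴.IsPrime → (𝔴.map (quotMap c j hq hP)).IsPrime) ∧ ∀ b, b ∈ 𝔴 ↔ quotMap c j hq hP b ∈ 𝔴.map (quotMap c j hq hP) := by
  have hker : RingHom.ker (quotMap c j hq hP) ≤ 𝔴 := ker_quotMap_le c j hq hP h𝔴
  refine ⟨fun h => Ideal.map_isPrime_of_surjective (quotMap_surjective c j hq hP) hker, fun b => ⟨Ideal.mem_map_of_mem _, fun hb => ?_⟩⟩
  have h2 := Ideal.mem_comap.mpr hb
  rw [Ideal.comap_map_of_surjective _ (quotMap_surjective c j hq hP)] at h2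
  refine (sup_le le_rfl ?_ : 𝔴 ⊔ Ideal.comap _ ⊥ ≤ 𝔴) h2
  rw [← RingHom.ker_eq_comap_bot]; exact hker

/-- **The fibre over the generic point of the curve survives in `K[X]`, `K = Frac(A/𝔓)`**: for a prime `𝔴 ⊆ B_j` with
`φ⁻¹ 𝔴 = 𝔓` the image `Φ(𝔴) ⊆ (A/𝔓)[X]` misses the non-zero constants, so `Φ(𝔴)·K[X]` is a prime `𝔫` with
`b ∈ 𝔴 ↔ Φ_K b ∈ 𝔫`, `Φ_K = (K ⊗ ·) ∘ Φ`. [cite: StacksProject, Tag 00UI] -/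
theorem generic_fibre [P.IsPrime] {K : Type} [Field K] [Algebra (A ⧸ P) K] [IsFractionRing (A ⧸ P) K]
    {𝔴 : Ideal (chartRing c j)} (h𝔴p : 𝔴.IsPrime) (h𝔴 : 𝔴.comap (chartBase c j) = P) :
    ∃ 𝔫 : Ideal (MvPolynomial {i : Fin m // i ≠ j} K), 𝔫.IsPrime ∧
      ∀ b, b ∈ 𝔴 ↔ (MvPolynomial.map (algebraMap (A ⧸ P) K)).comp (quotMap c j hq hP) b ∈ 𝔫 := by
  classical
  have hcj : chartBase c j (c j) ∈ 𝔴 := by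
    rw [← Ideal.mem_comap, h𝔴, ← hP]; exact Ideal.subset_span ⟨j, rfl⟩
  obtain ⟨hprime, hrefl⟩ := map_quotMap_reflects c j hq hP hcj
  set 𝔔 := 𝔴.map (quotMap c j hq hP)
  have h𝔔 : 𝔔.IsPrime := hprime h𝔴p
  letI : Algebra (MvPolynomial {i : Fin m // i ≠ j} (A ⧸ P)) (MvPolynomial {i : Fin m // i ≠ j} K) :=
    MvPolynomial.algebraMvPolynomial
  haveI : IsLocalization ((nonZeroDivisors (A ⧸ P)).map (C (σ := {i : Fin m // i ≠ j})))
      (MvPolynomial {i : Fin m // i ≠ j} K) := MvPolynomial.isLocalization _ _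
  have hdisj : Disjoint (((nonZeroDivisors (A ⧸ P)).map (C (σ := {i : Fin m // i ≠ j})) : Submonoid _) :
      Set (MvPolynomial {i : Fin m // i ≠ j} (A ⧸ P))) (SetLike.coe 𝔔) := by
    refine Set.disjoint_left.mpr ?_
    rintro _ ⟨r, hr, rfl⟩ hr𝔔
    obtain ⟨a, rfl⟩ := Ideal.Quotient.mk_surjective r
    have ha : chartBase c j a ∈ 𝔴 := (hrefl _).mpr (by rwa [quotMap_base])
    have ha0 : Ideal.Quotient.mk P a = 0 := Ideal.Quotient.eq_zero_iff_mem.mpr (by rw [← h𝔴]; exact ha)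
    rw [ha0] at hr
    exact (nonZeroDivisors.ne_zero hr) rfl
  refine ⟨𝔔.map (algebraMap _ _), IsLocalization.isPrime_of_isPrime_disjoint _ _ 𝔔 h𝔔 hdisj, fun b => ?_⟩
  rw [hrefl, RingHom.comp_apply, ← MvPolynomial.algebraMap_def]
  constructor
  · exact Ideal.mem_map_of_mem _
  · intro hb
    have h := Ideal.mem_comap.mpr hb
    rwa [← Ideal.under_def, IsLocalization.under_map_of_isPrime_disjoint _ _ h𝔔 hdisj] at h

end QuotMap

/-! ## §O  The origin over the curve prime -/

section Origin

open MvPolynomial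

variable {m : ℕ} (c : Fin m → A) (j : Fin m)

/-- THE ORIGIN OVER `𝔓`: `𝔴̃₀ = (e_l : l ≠ j) + (φ c_j) ⊆ B_j`. [this node] -/
noncomputable def originP : Ideal (chartRing c j) :=
  Ideal.span (Set.range fun l : {i : Fin m // i ≠ j} => chartGen c j l.1) ⊔ Ideal.span {chartBase c j (c j)}

/-- `𝔴̃₀ ⊆ 𝔴` for every ideal `𝔴` with `φ(𝔓) ⊆ 𝔴` containing the `e_l` (in particular the closed origin).
[folklore] -/
theorem originP_le {P : Ideal A} (hP : Ideal.span (Set.range c) = P) {𝔴 : Ideal (chartRing c j)}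
    (hP𝔴 : ∀ a ∈ P, chartBase c j a ∈ 𝔴) (hgen : ∀ l, l ≠ j → chartGen c j l ∈ 𝔴) : originP c j ≤ 𝔴 := by
  refine sup_le (Ideal.span_le.mpr ?_) ((Ideal.span_singleton_le_iff_mem _).mpr (hP𝔴 _ ?_))
  · rintro _ ⟨⟨l, hl⟩, rfl⟩; exact hgen l hl
  · rw [← hP]; exact Ideal.subset_span ⟨j, rfl⟩

/-- `𝔴̃₀ = ker(B_j ↠ (A/𝔓)[X] ↠ A/𝔓)` (all `X_l ↦ 0`). [folklore] -/
theorem originP_eq_ker (hq : IsQuasiRegular c) {P : Ideal A} (hP : Ideal.span (Set.range c) = P) : originP c j = RingHom.ker (constantCoeff.comp (quotMap c j hq hP)) := by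
  classical
  apply le_antisymm
  · refine originP_le c j hP (fun a ha => ?_) (fun l hl => ?_)
    · rw [RingHom.mem_ker, RingHom.comp_apply, quotMap_base, constantCoeff_C, Ideal.Quotient.eq_zero_iff_mem]; exact ha
    · rw [RingHom.mem_ker, RingHom.comp_apply, quotMap_gen c j hq hP hl, constantCoeff_X]
  · intro b hb
    rw [RingHom.mem_ker, RingHom.comp_apply] at hb
    have hb' : quotMap c j hq hP b ∈ (Ideal.span (Set.range fun l : {i : Fin m // i ≠ j} => chartGen c j l.1)).map
        (quotMap c j hq hP) := by
      rw [Ideal.map_span, ← Set.range_comp]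
      have hX : (quotMap c j hq hP ∘ fun l : {i : Fin m // i ≠ j} => chartGen c j l.1) = X :=
        funext fun l => quotMap_gen c j hq hP l.2
      rw [hX]
      exact mem_span_X_of_constantCoeff hb
    have h2 := Ideal.mem_comap.mpr hb'
    rw [Ideal.comap_map_of_surjective _ (quotMap_surjective c j hq hP)] at h2
    refine (sup_le le_sup_left ?_ : _ ⊔ Ideal.comap _ ⊥ ≤ originP c j) h2
    rw [← RingHom.ker_eq_comap_bot]
    exact ker_quotMap_le c j hq hP (Ideal.mem_sup_right (Ideal.subset_span rfl))

/-- `𝔴̃₀` is prime (for `𝔓` prime). [folklore] -/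
theorem originP_isPrime (hq : IsQuasiRegular c) {P : Ideal A} (hP : Ideal.span (Set.range c) = P) [P.IsPrime] : (originP c j).IsPrime := by
  rw [originP_eq_ker c j hq hP]
  exact RingHom.ker_isPrime _

/-- `φ⁻¹ 𝔴̃₀ = 𝔓`. [folklore] -/
theorem comap_originP (hq : IsQuasiRegular c) {P : Ideal A} (hP : Ideal.span (Set.range c) = P) : (originP c j).comap (chartBase c j) = P := by
  ext a
  rw [originP_eq_ker c j hq hP, Ideal.mem_comap, RingHom.mem_ker, RingHom.comp_apply, quotMap_base, constantCoeff_C,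
    Ideal.Quotient.eq_zero_iff_mem]

/-- **Uniqueness of the origin over `𝔓`**: an ideal `𝔴` with `φ⁻¹ 𝔴 = 𝔓` containing every `e_l`, `l ≠ j`, IS `𝔴̃₀`.
[folklore] -/
theorem eq_originP (hq : IsQuasiRegular c) {P : Ideal A} (hP : Ideal.span (Set.range c) = P)
    {𝔴 : Ideal (chartRing c j)} (h𝔴 : 𝔴.comap (chartBase c j) = P)
    (hgen : ∀ l, l ≠ j → chartGen c j l ∈ 𝔴) : 𝔴 = originP c j := by
  classical
  have hP𝔴 : ∀ a ∈ P, chartBase c j a ∈ 𝔴 := fun a ha => by rw [← Ideal.mem_comap, h𝔴]; exact ha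
  refine le_antisymm (fun b hb => ?_) (originP_le c j hP hP𝔴 hgen)
  have hcj : chartBase c j (c j) ∈ 𝔴 := hP𝔴 _ (by rw [← hP]; exact Ideal.subset_span ⟨j, rfl⟩)
  obtain ⟨-, hrefl⟩ := map_quotMap_reflects c j hq hP hcj
  rw [originP_eq_ker c j hq hP, RingHom.mem_ker, RingHom.comp_apply]
  set F := quotMap c j hq hP b with hF
  obtain ⟨a, ha⟩ := Ideal.Quotient.mk_surjective (constantCoeff F)
  -- `F − C(F(0)) ∈ (X) ⊆ Φ(𝔴)`, so `C(F(0)) = Φ(φ a) ∈ Φ(𝔴)`, `φ a ∈ 𝔴`, `a ∈ 𝔓`, `F(0) = ā = 0`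
  have h1 : F - C (constantCoeff F) ∈ 𝔴.map (quotMap c j hq hP) := by
    have hX : F - C (constantCoeff F) ∈ Ideal.span (Set.range (X : _ → MvPolynomial {i : Fin m // i ≠ j} (A ⧸ P))) :=
      mem_span_X_of_constantCoeff (by simp)
    refine (Ideal.span_le.mpr ?_) hX
    rintro _ ⟨⟨l, hl⟩, rfl⟩
    rw [SetLike.mem_coe, ← quotMap_gen c j hq hP hl]
    exact Ideal.mem_map_of_mem _ (hgen l hl)
  have h2 : C (constantCoeff F) ∈ 𝔴.map (quotMap c j hq hP) :=
    (Submodule.sub_mem_iff_right _ ((hrefl b).mp hb)).mp h1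
  rw [← ha, ← quotMap_base c j hq hP, ← hrefl] at h2
  rw [← ha, Ideal.Quotient.eq_zero_iff_mem, ← h𝔴, Ideal.mem_comap]
  exact h2

/-- The images of the generators of `𝔴̃₀` along a ring map `χ : B_j → S` with `χ ∘ φ = σ`: `χ(𝔴̃₀) S` is spanned by
the `χ e_l`, `l ≠ j`, and `σ c_j`. [folklore] -/
theorem map_originP {S : Type} [CommRing S] (χ : chartRing c j →+* S) (σ : A →+* S)
    (hσ : ∀ x, χ (chartBase c j x) = σ x) :
    (originP c j).map χ = Ideal.span (Set.range (fun l : {i : Fin m // i ≠ j} => χ (chartGen c j l.1)) ∪ {σ (c j)}) := by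
  rw [originP, Ideal.map_sup, Ideal.map_span, Ideal.map_span, Set.image_singleton, ← Set.range_comp, hσ, Ideal.span_union]
  rfl

end Origin

/-! ## §G  The generic law of a split shape -/

section Generic

open MvPolynomial

variable [IsLocalRing A] {J P : Ideal A} {n k : ℕ}

/-- **THE GENERIC LAW**: for a split shape `D` with curve prime `𝔓 = (c)`, a chart `j`, a prime `𝔴 ⊆ B_j` OVER `𝔓`
(`φ⁻¹ 𝔴 = 𝔓`) and its local ring `S = (B_j)_𝔴`: if the controlled transform `(J S : tⁿ)` lies in `𝔪_Sⁿ` then `j = 2`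
and every `e_l ∈ 𝔴` — the point is THE ORIGIN OVER `𝔓` of the `W`-chart.  (Abstract `NotPow` chart law with
`K = Frac(A/𝔓)`, the `NotPow` of the vertex coefficients modulo `𝔓`, and the generic fibre.)
[cite: Hironaka1964, Ch. III §3] [cite: CossartJannsenSaito2020, Ch. 8] -/
theorem SplitShape.generic_chart (D : SplitShape J P n k) (hn : 2 ≤ n) (hnk : n ≤ k) (j : Fin 3)
    (𝔴 : PrimeSpectrum (chartRing D.c j)) {S : Type} [CommRing S] [IsLocalRing S] (χ : chartRing D.c j →+* S)
    (hlocχ : @IsLocalization.AtPrime _ _ S _ χ.toAlgebra 𝔴.asIdeal _) (h𝔴 : 𝔴.asIdeal.comap (chartBase D.c j) = P)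
    (σ : A →+* S) (hσ : ∀ x, χ (chartBase D.c j x) = σ x)
    (hle : Submodule.colon (J.map σ) ((Ideal.span {σ (D.c j)} ^ n : Ideal S) : Set S) ≤ maximalIdeal S ^ n) :
    j = 2 ∧ ∀ l, l ≠ j → chartGen D.c j l ∈ 𝔴.asIdeal := by
  classical
  haveI : P.IsPrime := D.isPrime
  obtain ⟨𝔫, h𝔫, hΦ𝔴⟩ := generic_fibre D.c j D.rsop.isQuasiRegular D.span_c (K := FractionRing (A ⧸ P)) 𝔴.isPrime h𝔴
  have hn1 : 1 ≤ n := le_trans (by norm_num) hn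
  refine notPow_chart_of_fibre D.c D.mem_ideal D.tail hn1 (D.succ_le hnk) D.G_zero j 𝔴 χ hlocχ σ hσ
    ((algebraMap (A ⧸ P) (FractionRing (A ⧸ P))).comp (Ideal.Quotient.mk P)) (D.notPow_quot hn)
    ((MvPolynomial.map (algebraMap (A ⧸ P) (FractionRing (A ⧸ P)))).comp (quotMap D.c j D.rsop.isQuasiRegular D.span_c))
    (fun l hl => ?_) (fun a => ?_) ?_ 𝔫 h𝔫 hΦ𝔴 hle
  · rw [RingHom.comp_apply, quotMap_gen _ _ _ _ hl, map_X]
  · rw [RingHom.comp_apply, quotMap_base, map_C, RingHom.comp_apply]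
  · rw [RingHom.comp_apply, Ideal.Quotient.eq_zero_iff_mem.mpr (D.span_c.le (Ideal.subset_span ⟨j, rfl⟩)), map_zero]

/-- **THE GENERIC LAW, `W`-chart form**: a prime `𝔴` of the `W`-chart over `𝔓` whose local ring has `(J S : tⁿ) ⊆ 𝔪_Sⁿ`
IS the origin over `𝔓`: `𝔴 = 𝔴̃₀`. [this node] -/
theorem SplitShape.generic_chart_two (D : SplitShape J P n k) (hn : 2 ≤ n) (hnk : n ≤ k)
    (𝔴 : PrimeSpectrum (chartRing D.c 2)) {S : Type} [CommRing S] [IsLocalRing S] (χ : chartRing D.c 2 →+* S)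
    (hlocχ : @IsLocalization.AtPrime _ _ S _ χ.toAlgebra 𝔴.asIdeal _) (h𝔴 : 𝔴.asIdeal.comap (chartBase D.c 2) = P)
    (σ : A →+* S) (hσ : ∀ x, χ (chartBase D.c 2 x) = σ x)
    (hle : Submodule.colon (J.map σ) ((Ideal.span {σ (D.c 2)} ^ n : Ideal S) : Set S) ≤ maximalIdeal S ^ n) :
    𝔴.asIdeal = originP D.c 2 :=
  eq_originP D.c 2 D.rsop.isQuasiRegular D.span_c h𝔴 (D.generic_chart hn hnk 2 𝔴 χ hlocχ h𝔴 σ hσ hle).2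

end Generic

end Summit.ResolutionOfSingularities.ResolutionOfSingularities.Theorems.SplitTower
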